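import Mathlib
import HarnessLib

/-!
# NE7ConstrainedGreenIdentity — row NE7 (node U5), the (A)-bill's XL(c) docking, file D4 of `t4/b2b-balaban-t4-ne7-p2/g84/XLC-DOCKING-MEMO.md`:
# THE CONSTRAINED GREEN OPERATOR `C = G − G·Qᵀ·(Q·G·Qᵀ)⁻¹·Q·G` OF AN INVERTIBLE (PENALISED) OPERATOR `S = G⁻¹` SOLVES THE HARD-CONSTRAINED
# PROBLEM — `Q·C = 0` and `S·C·h − h ∈ range Qᵀ` — AND THE PENALTY `Qᵀ·A·Q` DROPS OUT ON `ker Q` (pure linear algebra, Mathlib only)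

Lineage `b2b-balaban-t4-ne7-p2` (CRUX PROVER NE7 #2, co-owner of row NE7), generation 84; companion of (137) `NE7FlatSliceSourceDuality`, (138)
`NE7FlatSliceNormalForm` (the slice identity in LAGRANGE form: `hess 1 X Y = ℓ Y + μ (Q Y)` on all skew periodic `Y`), (139) `NE7FlatSliceStraightReduction`.
WHY.  The supplier of the END's slice solver letter `G♭` (the XL(c) driver) docks to lit-balaban's kernel-proved Proposition 1.2 for Bałaban's B5 propagator
`G = Δ_a⁻¹`, `Δ_a = Δ − ∂P∂* + a·Q*Q` ((1.69)∕(1.73), `B5DeltaA169.DeltaA`; (1.115) `B5Prop12GHolds.global115_117_famG_printed`), whose constraint is SOFT (penalty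
`a·Q*Q`), while the END's slice is the HARD constraint `Q X = 0` with a Lagrange multiplier ((138) `exists_multiplier_of_sliceIdentity`).  The bridge is the
constrained-minimiser (Schur ∕ Woodbury) identity, valid for EVERY `a`: with `G = S⁻¹` and `D = Q·G·Qᵀ` invertible, `C := G − G·Qᵀ·D⁻¹·Q·G` has `Q·C = 0`
(**`Q_comp_constrainedGreen`**) and `S·(C h) = h − Qᵀ(D⁻¹ Q G h)` (**`S_constrainedGreen_apply`**), so `C h` solves the hard-constrained equation
`S (C h) − h ∈ range Qᵀ` (**`S_constrainedGreen_sub_mem_range`**); and if `S = S₀ + Qᵀ·A·Q` (penalty form) then ALSO `S₀ (C h) − h ∈ range Qᵀ`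
(**`S0_constrainedGreen_sub_mem_range`**) — the penalty never acts on `ker Q`.  In weak form, against any pairing for which `Qᵀ` is adjoint to `Q`:
`B (S₀ (C h)) y = B h y` for every `y ∈ ker Q` (**`pairing_S0_constrainedGreen_eq`**) — the shape of (138)'s Lagrange identity with `ℓ = B h`.
So the supplier's task (memo §4, file D5) is: instantiate `S := Δ_a` (unit-lattice transport of `DeltaA`), read `curl ∘ C` through (1.115)'s entries and a
bound for `D⁻¹ = (Q G Qᵀ)⁻¹`, and feed (139) → (137) → the END.
HOW ([folklore]).  Ring algebra of linear maps over a commutative ring; right inverses suffice (`S ∘ G = id`, `D ∘ D⁻¹ = id`).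
HONEST FRAMING (page 1): [folklore] linear algebra, Mathlib only; NO estimate; nothing of Bałaban's asserted; the invertibility of `S` and of `Q G Qᵀ` are
HYPOTHESES (for B5's `Δ_a` they are Prop. 1.1 ∕ the positivity of p. 30, in lit-balaban); NOT (APE), NOT ONE-STEP, NOT NE7; spine 0∕9; finite T⁴ rung (B)+1 —
NOT infinite volume, NOT mass gap, NOT Clay.  Continuum YM on T⁴ ⇐ BetaPertH ∧ nine spine estimates (0/9 proved); BetaPertH ⇐ (D1) ∧ (D4) ∧ CAP+tail; G-an2-4
gates asym, D1 and NE2/3/4.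
-/

set_option autoImplicit false

namespace Summit.QuantumFields.BalabanUV.T4Continuum.NE7ConstrainedGreenIdentity

variable {R : Type*} [CommRing R] {E F : Type*} [AddCommGroup E] [Module R E] [AddCommGroup F] [Module R F]

/-- **THE CONSTRAINED GREEN OPERATOR** `C = G − G·Qᵀ·D⁻¹·Q·G` built from a Green operator `G` (inverse of the penalised operator), the constraint `Q`, its
transpose `Qt` and an inverse `Dinv` of `D = Q·G·Qᵀ`. [folklore] -/
def constrainedGreen (G : E →ₗ[R] E) (Q : E →ₗ[R] F) (Qt : F →ₗ[R] E) (Dinv : F →ₗ[R] F) : E →ₗ[R] E :=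
  G - G ∘ₗ Qt ∘ₗ Dinv ∘ₗ Q ∘ₗ G

/-- unfolding. [folklore] -/
theorem constrainedGreen_apply (G : E →ₗ[R] E) (Q : E →ₗ[R] F) (Qt : F →ₗ[R] E) (Dinv : F →ₗ[R] F) (h : E) :
    constrainedGreen G Q Qt Dinv h = G h - G (Qt (Dinv (Q (G h)))) := rfl

/-- **`Q·C = 0`**: the constrained Green operator maps into `ker Q` (needs `D·D⁻¹ = id`, `D = Q·G·Qᵀ`). [folklore] -/
theorem Q_constrainedGreen_apply (G : E →ₗ[R] E) (Q : E →ₗ[R] F) (Qt : F →ₗ[R] E) (Dinv : F →ₗ[R] F)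
    (hD : ∀ f : F, Q (G (Qt (Dinv f))) = f) (h : E) : Q (constrainedGreen G Q Qt Dinv h) = 0 := by
  rw [constrainedGreen_apply, map_sub, hD, sub_self]

/-- `Q ∘ C = 0` as linear maps. [folklore] -/
theorem Q_comp_constrainedGreen (G : E →ₗ[R] E) (Q : E →ₗ[R] F) (Qt : F →ₗ[R] E) (Dinv : F →ₗ[R] F)
    (hD : ∀ f : F, Q (G (Qt (Dinv f))) = f) : Q ∘ₗ constrainedGreen G Q Qt Dinv = 0 :=
  LinearMap.ext fun h => Q_constrainedGreen_apply G Q Qt Dinv hD h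

/-- **`S·(C h) = h − Qᵀ(D⁻¹ Q G h)`** (needs `S·G = id`). [folklore] -/
theorem S_constrainedGreen_apply (S G : E →ₗ[R] E) (Q : E →ₗ[R] F) (Qt : F →ₗ[R] E) (Dinv : F →ₗ[R] F) (hSG : ∀ x : E, S (G x) = x) (h : E) :
    S (constrainedGreen G Q Qt Dinv h) = h - Qt (Dinv (Q (G h))) := by
  rw [constrainedGreen_apply, map_sub, hSG, hSG]

/-- **THE HARD-CONSTRAINED EQUATION**: `S (C h) − h ∈ range Qᵀ` (with multiplier `−D⁻¹ Q G h`). [folklore] -/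
theorem S_constrainedGreen_sub_mem_range (S G : E →ₗ[R] E) (Q : E →ₗ[R] F) (Qt : F →ₗ[R] E) (Dinv : F →ₗ[R] F)
    (hSG : ∀ x : E, S (G x) = x) (h : E) : S (constrainedGreen G Q Qt Dinv h) - h ∈ LinearMap.range Qt := by
  refine ⟨-Dinv (Q (G h)), ?_⟩
  rw [S_constrainedGreen_apply S G Q Qt Dinv hSG, map_neg]
  abel

/-- **THE PENALTY DROPS OUT ON `ker Q`**: if `S = S₀ + Qᵀ·A·Q` (penalised operator) then also `S₀ (C h) − h ∈ range Qᵀ` — the constrained Green operator of the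
PENALISED operator solves the hard-constrained problem for the UNPENALISED one. [folklore] -/
theorem S0_constrainedGreen_sub_mem_range (S S₀ G : E →ₗ[R] E) (Q : E →ₗ[R] F) (Qt : F →ₗ[R] E) (A Dinv : F →ₗ[R] F)
    (hS : ∀ x : E, S x = S₀ x + Qt (A (Q x))) (hSG : ∀ x : E, S (G x) = x) (hD : ∀ f : F, Q (G (Qt (Dinv f))) = f) (h : E) :
    S₀ (constrainedGreen G Q Qt Dinv h) - h ∈ LinearMap.range Qt := by
  obtain ⟨m, hm⟩ := S_constrainedGreen_sub_mem_range S G Q Qt Dinv hSG h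
  have hQ : Q (constrainedGreen G Q Qt Dinv h) = 0 := Q_constrainedGreen_apply G Q Qt Dinv hD h
  refine ⟨m - A (Q (constrainedGreen G Q Qt Dinv h)), ?_⟩
  rw [map_sub, hm, hS]
  abel

/-- The multiplier explicitly: `S₀ (C h) = h + Qᵀ (−D⁻¹ Q G h − A (Q (C h)))`, and `Q (C h) = 0` so the `A`-term is `Qᵀ (A 0) = 0`:
`S₀ (C h) = h − Qᵀ (D⁻¹ (Q (G h)))`. [folklore] -/
theorem S0_constrainedGreen_apply (S S₀ G : E →ₗ[R] E) (Q : E →ₗ[R] F) (Qt : F →ₗ[R] E) (A Dinv : F →ₗ[R] F)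
    (hS : ∀ x : E, S x = S₀ x + Qt (A (Q x))) (hSG : ∀ x : E, S (G x) = x) (hD : ∀ f : F, Q (G (Qt (Dinv f))) = f) (h : E) :
    S₀ (constrainedGreen G Q Qt Dinv h) = h - Qt (Dinv (Q (G h))) := by
  have h1 := S_constrainedGreen_apply S G Q Qt Dinv hSG h
  rw [hS, Q_constrainedGreen_apply G Q Qt Dinv hD h, map_zero, map_zero, add_zero] at h1
  exact h1

/-- **WEAK FORM** (the shape of (138)'s Lagrange identity with `ℓ = B h`): for any pairings `B` on `E` and `B'` between `F` and `E` such that `Qᵀ` is adjoint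
to `Q` (`B (Qt f) y = B' f (Q y)`), the constrained Green operator of the penalised `S = S₀ + Qᵀ·A·Q` satisfies `B (S₀ (C h)) y = B h y` for every
`y ∈ ker Q`. [folklore] -/
theorem pairing_S0_constrainedGreen_eq {P : Type*} [AddCommGroup P] [Module R P] (S S₀ G : E →ₗ[R] E) (Q : E →ₗ[R] F) (Qt : F →ₗ[R] E)
    (A Dinv : F →ₗ[R] F) (hS : ∀ x : E, S x = S₀ x + Qt (A (Q x))) (hSG : ∀ x : E, S (G x) = x) (hD : ∀ f : F, Q (G (Qt (Dinv f))) = f)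
    (B : E →ₗ[R] E →ₗ[R] P) (B' : F →ₗ[R] F →ₗ[R] P) (hadj : ∀ (f : F) (y : E), B (Qt f) y = B' f (Q y)) {y : E} (hy : Q y = 0) (h : E) :
    B (S₀ (constrainedGreen G Q Qt Dinv h)) y = B h y := by
  rw [S0_constrainedGreen_apply S S₀ G Q Qt A Dinv hS hSG hD h, map_sub, LinearMap.sub_apply, hadj, hy, map_zero, sub_zero]

/-- **UNIQUENESS OF THE CONSTRAINED SOLUTION MODULO THE KERNEL OF THE PAIRED OPERATOR**: if `x, x' ∈ ker Q` both satisfy the weak equation against all of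
`ker Q`, then `B (S₀ (x − x')) y = 0` for all `y ∈ ker Q` — in particular `B (S₀ (x − x')) (x − x') = 0`, which for the flat Hessian (`S₀ = δd`, `B` the curl
pairing) is (138)'s `curlAt_flat_eq_zero_of_hess_self_eq_zero` input. [folklore] -/
theorem pairing_sub_eq_zero_of_weak (S₀ : E →ₗ[R] E) (Q : E →ₗ[R] F) {P : Type*} [AddCommGroup P] [Module R P] (B : E →ₗ[R] E →ₗ[R] P)
    (ℓ : E →ₗ[R] P) {x x' : E} (hx : ∀ y : E, Q y = 0 → B (S₀ x) y = ℓ y) (hx' : ∀ y : E, Q y = 0 → B (S₀ x') y = ℓ y)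
    {y : E} (hy : Q y = 0) : B (S₀ (x - x')) y = 0 := by
  rw [map_sub, map_sub, LinearMap.sub_apply, hx y hy, hx' y hy, sub_self]

end Summit.QuantumFields.BalabanUV.T4Continuum.NE7ConstrainedGreenIdentity
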